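import Summits.ResolutionOfSingularities.ResolutionOfSingularities.Theorems.SplitCutKernels2
import HarnessLib

/-!
# SplitCutClasses — decomp-res node «SplitCut» (lens-2 g17)

Content VERBATIM from the decomp-res lens-2 g17 node `HOME/decomp-res-lens-2/g17/SplitCut.lean` (pin 301f7a3a, 2 469
l; parts in `g17/parts/`, SHA256SUMS verified by the critic;
HOME = run/shared/lean/pub/decomp-res; CRITIC-LEDGER row 146 (claim DECIDED-MOD-PORT(M+) +1 under row 140's window
(ii)); landing orders INBOX :365: land AFTER the PurityCut
chain with ALL restated sections (§R16, §R, §G, §P, §H — l. 244–2018: the lens's verbatim-in-body copies of lens-2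
g14 `PinchCut`, g15 `JetCut` rev 5 and g16 `PurityCut` rev 1)
DELETED and the landed modules imported instead (namespaces `…Theorems.PinchCut`, `…Theorems.JetCut` (+ `Vast`),
`…Theorems.PurityCut` (+ `Leaf`, `Grand`) opened; same short
names, byte-identical bodies — never two copies).  Namespace `…Theorems.SplitCut` (the lens's `Theses.SplitCut` is
gate-reserved), sub-namespace `Split` as in the lens;
file split only (tree files ≤ 400 lines): sections, variables and every declaration exactly as in the lens; the
node's global dupNamespace-linter line dropped.  Node files,
in import order: `SplitCutKernels` (§S1) · `SplitCutClasses` (§S2 + the cone-free head of §T) · `SplitCutCells`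
(§T2–§T4 cone-free: the aside home) · the wiring
`MaxContactCutSplitCut` (§T BY NAME on the host route, in the Theses cone).  All `--supports
stmt-ResolutionOfSingularities-29273` (`MaxContactCut.RungOne`); nothing closes
29273 — decided halves carry their engines as hypotheses; exactly ONE located-residual aside on the lens-2 column
(`Split.SplitSpecialRung`, home `SplitCutCells`) SUPERSEDES
g16's `Grand.GrandSpecialRung`, re-located EXACTLY modulo the split decided half (`grandSpecialRung_iff_splitSpecialRung`).

§S2 (NEW, g17): point level — `MiddleCoeff`, `VertexTame`, `SplitConeShape`, `IsSplitConeAt`,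
`IsUniformSplitConeCurve`, the ENGINE (S) `def SplitConeExit : Prop` (EXACT-ON-PAPER, carried as a hypothesis like
the other engines; cites in its docstring), `IsSplitConeCurvePt`, `isCurveExitPt_of_isSplitConeCurvePt`, the split
leaf `splitLeaf = grandLeaf ∨ (S)` with its three order lemmas, `splitLeaf_of_isSplitConeCurvePt`, THE LOCATED
RESIDUAL CLASS `IsSplitSpecialPt`, `isSpecPt_splitLeaf_iff`, `isGrandSpecialPt_of_isSplitSpecialPt`,
`isGrandSpecialPt_iff` (§T head, cone-free).

(Sources: Hironaka1964 Ch. III; CossartJannsenSaito2020 Ch. 2, Ch. 8–9; CossartPiltant2008 Prop. 4.2;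
CossartPiltant2019 Rem. 3.2; BierstoneGrigorievMilmanWlodarczyk2011 §3.1; Moh1987; Hauser2010Kangaroo; Giraud1975;
Narasimhan1983.)
-/

open CategoryTheory AlgebraicGeometry TopologicalSpace IsLocalRing
open Literature.AlgebraicGeometry.Resolution
open Summit.ResolutionOfSingularities.ResolutionOfSingularities.Theorems
open Summit.ResolutionOfSingularities.ResolutionOfSingularities.Theorems.WeakOrderReduction
open Summit.ResolutionOfSingularities.ResolutionOfSingularities.Theorems.DeltaFaceCutClasses
open Summit.ResolutionOfSingularities.ResolutionOfSingularities.Theorems.RelativeDeltaCut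
open Summit.ResolutionOfSingularities.ResolutionOfSingularities.Theorems.CurveLeafExit
open Summit.ResolutionOfSingularities.ResolutionOfSingularities.Theorems.PinchCut
open Summit.ResolutionOfSingularities.ResolutionOfSingularities.Theorems.JetCut
open Summit.ResolutionOfSingularities.ResolutionOfSingularities.Theorems.PurityCut

namespace Summit.ResolutionOfSingularities.ResolutionOfSingularities.Theorems.SplitCut

/-! ### §S2  point level — split-cone points, uniformly shaped curves, ENGINE (S), the SPLIT-CONE-CURVE class -/

/-- **SPLIT-CONE-SHAPED at `y` transversal to `η` with exponents `(n, k)`** [g17] (`IsSplitConeAt I n k η y`): germ dimension 4,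
regular parameters `c = (z, U, W)` generating the curve prime and extendable to a regular system (`(c, v) = 𝔪_y`: the curve is
REGULAR at `y`), `I_y = (f)` PRINCIPAL, and `f` of split-cone shape for SOME coefficient family `G`, transversal-or-unit `ϖ`,
unit `ε` and tail `r` (existential per point; `(n, k)` uniform).  DEFINITION (NEW class predicate). (Sources:
CossartJannsenSaito2020 Ch. 2; folklore.) -/
def IsSplitConeAt {Y : Scheme.{0}} (I : Y.IdealSheafData) (n k : ℕ) (η y : Y) : Prop :=
  ∃ h : η ⤳ y, ∃ (c : Fin 3 → Y.presheaf.stalk y) (v ϖ ε r f : Y.presheaf.stalk y) (G : ℕ → Y.presheaf.stalk y),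
    Ideal.span (Set.range c) = curvePrime h ∧
      Ideal.span (Set.range c ∪ {v}) = maximalIdeal (Y.presheaf.stalk y) ∧
      (maximalIdeal (Y.presheaf.stalk y)).spanFinrank = 4 ∧
      stalkIdeal I y = Ideal.span {f} ∧
      SplitConeShape (maximalIdeal (Y.presheaf.stalk y)) c ϖ G ε r f n k

/-- **UNIFORMLY SPLIT-CONE-SHAPED CURVE** [g17] (`IsUniformSplitConeCurve I n k η`): `η` is a curve point and EVERY closed point
of `closure {η}` is split-cone-shaped transversal to `η` with the SAME `(n, k)` (`G`, `ϖ`, `ε`, the tail vary with the point: at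
the core `ϖ` is the transversal parameter, elsewhere a unit).  The hypothesis of ENGINE (S).  DEFINITION (NEW class predicate).
 -/
def IsUniformSplitConeCurve {Y : Scheme.{0}} (I : Y.IdealSheafData) (n k : ℕ) (η : Y) : Prop :=
  IsCurvePt η ∧ ∀ y : Y, η ⤳ y → IsClosed ({y} : Set Y) → IsSplitConeAt I n k η y

/-- **ENGINE (S) `SplitConeExit`** [g17; DECIDED · paper proof = module docstring §2: `⌊k/n⌋` blow-ups of the section curves
`C_i = V(X₀, X₁, W)` (closures of the unique order-`n` point over the previous generic point); shape reproduction at the section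
points (`split_chart_identity`, `ladder_monomial_identity`, `ladder_weight_step`, KERNEL) with `G`, `ϖ`, `ε` UNCHANGED; depth
`ladder_depth` (KERNEL); last stage: order `k mod n < n` at the section point; AT EVERY STAGE over a point where the residue
binary form `B̄ = Σ Ḡ_j X₀^{n-j} X₁^j` has a middle term (unit points, the generic fibre): every other point of the exceptional
fibre has order `≤ mult(B̄) < n` (a degree-`n` binary form with a middle coefficient is not `λ·ℓⁿ` under the guard,
`no_middle_terms`), the `z`-chart point is off the transform (`splitCone_chartZ`); over the CORE (`Ḡ_j = 0`, `j ≥ 1`): the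
`W`-chart points with `x₀ ≠ 0` are off the transform, and along the whole FIBRE LINE `{X̄₀ = 0}` (closed points, its point at
infinity `splitCone_chartU`, its generic point) the order is `< n` or `= n` with initial form
`X̄₀ⁿ + ū·x₁^j·ϖ̄^j·X̄₀^{n-j} + …` restricted to `(X̄₀, ϖ̄)` — a binary form with a middle term, so `τ ≥ 2` (every tail and
corner monomial carries `W̄` resp. `Ū` by the weight `nk + 1`; an element of `𝒪_{Y,y}` never has a pure `X̄₀^b ϖ̄^a`, `b ≥ 1`,
initial monomial in the chart); these `τ = 2` points are LEFT STANDING — the conclusion of `PackageExitsOver` asks exactly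
`2 ≤ τ` at the surviving order-`n` points; permissibility of the `C_i` (`f_i ∈ (X₀, X₁, W)ⁿ`, `C_i ≅ C` regular); ingredients
of the port: HS 5.5.5, permissibility of regular centres in the top locus of a principal marked ideal, upper semicontinuity of
order, density of closed points — every characteristic and residue field of the frame]: on a regular scheme, a uniformly
split-cone-shaped curve of order `n ≥ 2` has an exit package with centres over it.  STATEMENT (engine). (Sources:
Hironaka1964; CossartJannsenSaito2020 Ch. 2, Ch. 8; CossartPiltant2008 Prop. 4.2; Giraud1975.) -/
def SplitConeExit : Prop :=
  ∀ (Y : Scheme.{0}), Scheme.IsRegular Y → ∀ (I : Y.IdealSheafData) (n : ℕ), 2 ≤ n → ∀ (k : ℕ) (η : Y),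
    IsUniformSplitConeCurve I n k η → PackageExitsOver I n {y : Y | η ⤳ y}

/-- **SPLIT-CONE-CURVE point** [g17] (NEW DECIDED CLASS, leaf (S)): `y` lies on (or is the generic point of) a Top-isolated,
uniformly split-cone-shaped curve.  Inhabitant: the core of census row `R1 = z² + v·z·(u₁+u₂) + u₁⁵ + u₂⁷` over `𝔽₂`
(`splitConeShape_R1`; Top `= V(z, u₁, u₂)` globally; `τ = 1`, no maximal contact; not in any earlier class: module docstring
§3 LEMMA Q_S), and of `R3` over `𝔽₃` (`represent_R3`).  DEFINITION (NEW class). -/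
def IsSplitConeCurvePt {Y : Scheme.{0}} (I : Y.IdealSheafData) (n : ℕ) (y : Y) : Prop :=
  ∃ (η : Y) (k : ℕ), η ⤳ y ∧ IsTopIsolatedClosure I n η ∧ IsUniformSplitConeCurve I n k η

/-- Under ENGINE (S), every split-cone-curve point is a curve-exit point of g12's port.  KERNEL (PROVED). [folklore] -/
theorem isCurveExitPt_of_isSplitConeCurvePt {Y : Scheme.{0}} {I : Y.IdealSheafData} {n : ℕ} {y : Y}
    (hS : SplitConeExit) (hY : Scheme.IsRegular Y) (hn : 2 ≤ n) (h : IsSplitConeCurvePt I n y) :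
    IsCurveExitPt I n y := by
  obtain ⟨η, k, hηy, hiso, hcurve⟩ := h
  exact ⟨η, hηy, hcurve.1, hiso, hS Y hY I n hn k η hcurve⟩

/-! ## §T  NEW (g17): the SPLIT cut — the split leaf `splitLeaf = grandLeaf ∨ (S)`, its located residual class
`IsSplitSpecialPt`, the rungs (instances of §G), `closes` BY NAME, the engines at work, and the EXACT RE-LOCATION of g16's
`Grand.GrandSpecialRung` (and of g15's `Vast.VastSpecialRung`, g14's `PinchSpecialRung`, the tree aside 33866
`MaxContactCut.LeafSpecialRung`) modulo the split decided half — all 0 sorry. -/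

/-- The SPLIT leaf of g17: pinch-curve ∨ cone-curve ∨ grand-curve ∨ SPLIT-CONE-curve.  DEFINITION (leaf instance). [folklore] -/
def splitLeaf : ∀ ⦃Y : Scheme.{0}⦄, Y.IdealSheafData → ℕ → Y → Prop :=
  fun _ I n y => IsPinchCurvePt I n y ∨ IsConeCurvePt I n y ∨ IsGrandCurvePt I n y ∨ IsSplitConeCurvePt I n y

/-- `grandLeaf_le_splitLeaf`: Auxiliary step of this node's calculus, VERBATIM from the lens file (see the module
docstring); the statement is its type. [folklore] -/
theorem grandLeaf_le_splitLeaf ⦃Y : Scheme.{0}⦄ (I : Y.IdealSheafData) (n : ℕ) (y : Y) :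
    grandLeaf I n y → splitLeaf I n y := by
  rintro (h | h | h)
  · exact Or.inl h
  · exact Or.inr (Or.inl h)
  · exact Or.inr (Or.inr (Or.inl h))

/-- `vastLeaf_le_splitLeaf`: Auxiliary step of this node's calculus, VERBATIM from the lens file (see the module
docstring); the statement is its type. [folklore] -/
theorem vastLeaf_le_splitLeaf ⦃Y : Scheme.{0}⦄ (I : Y.IdealSheafData) (n : ℕ) (y : Y) :
    vastLeaf I n y → splitLeaf I n y :=
  fun h => grandLeaf_le_splitLeaf I n y (vastLeaf_le_grandLeaf I n y h)

/-- `pinchLeaf_le_splitLeaf`: Auxiliary step of this node's calculus, VERBATIM from the lens file (see the module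
docstring); the statement is its type. [folklore] -/
theorem pinchLeaf_le_splitLeaf ⦃Y : Scheme.{0}⦄ (I : Y.IdealSheafData) (n : ℕ) (y : Y) :
    pinchLeaf I n y → splitLeaf I n y :=
  fun h => grandLeaf_le_splitLeaf I n y (pinchLeaf_le_grandLeaf I n y h)

/-- `splitLeaf_of_isSplitConeCurvePt`: Auxiliary step of this node's calculus, VERBATIM from the lens file (see the
module docstring); the statement is its type. [folklore] -/
theorem splitLeaf_of_isSplitConeCurvePt ⦃Y : Scheme.{0}⦄ {I : Y.IdealSheafData} {n : ℕ} {y : Y}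
    (h : IsSplitConeCurvePt I n y) : splitLeaf I n y :=
  Or.inr (Or.inr (Or.inr h))

/-- **SPLIT-SPECIAL point** [g17] — THE LOCATED RESIDUAL CLASS of this node: grand-special (g16) and NOT a
split-cone-curve point.
What is LEFT (booked, module docstring §5): principal germs whose cone is a PURE POWER `ℓ^{p^s}` along the curve or a DEEP split
(`(z + vU)²`: Top becomes a surface, census control `INSEP`; `z(z + v²U)`: `e > j`), cones with a SHALLOW LADDER
VERTEX and no middle unit (→ (L)/(D⁺) only
with their side clauses), split cones with `n ∣ k` (last stage not analysed), NON-PRINCIPAL `I_y` (critic (iii)),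
curves failing uniformity or Top-isolation (Tangle: `R1-notail`),
and the Sing / Iso columns (iv) (`HauserE7`, `Narasimhan`).  DEFINITION (NEW class). [folklore] -/
def IsSplitSpecialPt {k : Type} [Field k] {Y : Scheme.{0}} (g : Y ⟶ Spec (.of k)) (hY : Scheme.IsRegular Y)
    (I : Y.IdealSheafData) (n : ℕ) (y : Y) : Prop :=
  IsGrandSpecialPt g hY I n y ∧ ¬ IsSplitConeCurvePt I n y

/-- Pointwise: the split-special class IS the `splitLeaf`-special class of §G.  KERNEL (PROVED). [folklore] -/
theorem isSpecPt_splitLeaf_iff {k : Type} [Field k] {Y : Scheme.{0}} (g : Y ⟶ Spec (.of k)) (hY : Scheme.IsRegular Y)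
    (I : Y.IdealSheafData) (n : ℕ) (y : Y) : Leaf.IsSpecPt splitLeaf g hY I n y ↔ IsSplitSpecialPt g hY I n y := by
  constructor
  · rintro ⟨hL, hno⟩
    exact ⟨⟨⟨hL, fun h => hno (Or.inl h), fun h => hno (Or.inr (Or.inl h))⟩,
      fun h => hno (Or.inr (Or.inr (Or.inl h)))⟩, fun h => hno (Or.inr (Or.inr (Or.inr h)))⟩
  · rintro ⟨⟨⟨hL, hP, hC⟩, hG⟩, hS⟩
    refine ⟨hL, ?_⟩
    rintro (h | h | h | h)
    · exact hP h
    · exact hC h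
    · exact hG h
    · exact hS h

/-- The split-special class is contained in g16's grand-special class (the residual SHRINKS by letter).  KERNEL
(PROVED). [folklore] -/
theorem isGrandSpecialPt_of_isSplitSpecialPt {k : Type} [Field k] {Y : Scheme.{0}} {g : Y ⟶ Spec (.of k)}
    {hY : Scheme.IsRegular Y} {I : Y.IdealSheafData} {n : ℕ} {y : Y} (h : IsSplitSpecialPt g hY I n y) :
    IsGrandSpecialPt g hY I n y :=
  h.1

/-- EXACT POINTWISE DICHOTOMY of g16's residual class: grand-special ⟺ split-cone-curve ∨ split-special.  KERNEL
(PROVED). [folklore] -/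
theorem isGrandSpecialPt_iff {k : Type} [Field k] {Y : Scheme.{0}} (g : Y ⟶ Spec (.of k)) (hY : Scheme.IsRegular Y)
    (I : Y.IdealSheafData) (n : ℕ) (y : Y) :
    IsGrandSpecialPt g hY I n y ↔
      (IsGrandSpecialPt g hY I n y ∧ IsSplitConeCurvePt I n y) ∨ IsSplitSpecialPt g hY I n y := by
  constructor
  · intro h
    by_cases hs : IsSplitConeCurvePt I n y
    · exact Or.inl ⟨h, hs⟩
    · exact Or.inr ⟨h, hs⟩
  · rintro (⟨h, _⟩ | ⟨h, _⟩) <;> exact h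

end Summit.ResolutionOfSingularities.ResolutionOfSingularities.Theorems.SplitCut
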